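import Summits.QuantumAdvantage.QuantumAdvantage.Theses.LinnikCubicClassGroups

/-!
# Crux `LinnikCubicClassGroups.PureCubicClassGroupFBQP` (stmt-QuantumAdvantage-11544) — stub `stub_regulatorPeriod`

Line `arakelov-giant-step-cycle`, stub `stub_regulatorPeriod` (THE CIRCUMFERENCE OF THE CYCLE IS THE
REGULATOR): a cubic number field `K` with a real embedding `σ₁` and a non-real embedding `σ₂` has
signature `(1, 1)` and unit rank `1`; there is a unit `ε` with `σ₁ ε > 1` which is LEAST with this
property among the units of `𝓞 K`, and `log σ₁(ε)` is Mathlib's `NumberField.Units.regulator K`.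

Proof (Dirichlet's unit theorem, pure Mathlib): `σ₁` and `σ₂` give a real place `w₁ = |σ₁ ·|` and a
complex place `w₂`; `r₁ + 2 r₂ = 3` with `r₂ ≥ 1` forces `r₁ = r₂ = 1`, so every place `≠ w₂` is `w₁`,
`rank K = 1`, and `NumberField.Units.regulator_eq_det` at `w' = w₂` is the `1 × 1` determinant
`|mult w₁ · log w₁(g)| = |log |σ₁ g||` for the fundamental unit `g = fundSystem K _`. Every unit is
`ζ g^n` with `ζ` torsion (`exist_unique_eq_mul_prod`), and `w₁ ζ = 1`, so `|σ₁ u| = |σ₁ g|^n`. The unit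
`ε ∈ {±g, ±g⁻¹}` with `σ₁ ε = max (|σ₁ g|, |σ₁ g|⁻¹) > 1` works: `log σ₁ ε = |log |σ₁ g|| = regulator K`,
and a unit `u` with `σ₁ u > 1` has `σ₁ u = (σ₁ ε)^n` with `n ≥ 1`, hence `σ₁ u ≥ σ₁ ε`.
-/

namespace Summit.QuantumAdvantage.QuantumAdvantage.Theorems.LinnikCubicClassGroups

open scoped NumberField
open NumberField NumberField.InfinitePlace NumberField.Units

/-- A real embedding `σ : K →+* ℝ` defines a real infinite place, `x ↦ |σ x|`. -/
theorem exists_isReal_place_eq_abs {K : Type} [Field K] (σ : K →+* ℝ) :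
    ∃ w : InfinitePlace K, w.IsReal ∧ ∀ x : K, w x = |σ x| := by
  refine ⟨InfinitePlace.mk ((algebraMap ℝ ℂ).comp σ), isReal_mk_iff.mpr ?_, fun x => ?_⟩
  · rw [ComplexEmbedding.isReal_iff]
    exact RingHom.ext fun x => by simp [ComplexEmbedding.conjugate_coe_eq, Complex.conj_ofReal]
  · rw [InfinitePlace.apply]
    simp [Complex.norm_real]

/-- A non-real embedding `σ : K →+* ℂ` defines a complex infinite place. -/
theorem exists_isComplex_place {K : Type} [Field K] (σ : K →+* ℂ)
    (h : ∃ z : K, starRingEnd ℂ (σ z) ≠ σ z) : ∃ w : InfinitePlace K, w.IsComplex := by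
  obtain ⟨z, hz⟩ := h
  refine ⟨InfinitePlace.mk σ, isComplex_mk_iff.mpr fun hreal => hz ?_⟩
  rw [ComplexEmbedding.isReal_iff] at hreal
  simpa only [ComplexEmbedding.conjugate_coe_eq] using RingHom.congr_fun hreal z

/-- **Dirichlet for signature `(1, 1)`.** In a cubic number field with a real embedding `σ₁` and a
non-real embedding `σ₂` there is a unit `g` (a fundamental unit) with `regulator K = |log |σ₁ g||`
such that `|σ₁ u|` is an integer power of `|σ₁ g|` for every unit `u`. -/
theorem exists_unit_regulator_eq_abs_log {K : Type} [Field K] [NumberField K]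
    (h3 : Module.finrank ℚ K = 3) (σ₁ : K →+* ℝ) (σ₂ : K →+* ℂ)
    (hσ₂ : ∃ z : K, starRingEnd ℂ (σ₂ z) ≠ σ₂ z) :
    ∃ g : (𝓞 K)ˣ, regulator K = abs (Real.log |σ₁ (g : K)|) ∧
      ∀ u : (𝓞 K)ˣ, ∃ n : ℤ, |σ₁ (u : K)| = |σ₁ (g : K)| ^ n := by
  classical
  obtain ⟨w₁, hw₁, hw₁app⟩ := exists_isReal_place_eq_abs σ₁
  obtain ⟨w₂, hw₂⟩ := exists_isComplex_place σ₂ hσ₂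
  -- signature `(1, 1)`
  have hsig : nrRealPlaces K = 1 ∧ nrComplexPlaces K = 1 := by
    have h := card_add_two_mul_card_eq_rank K
    rw [h3] at h
    have hc : 0 < nrComplexPlaces K := Fintype.card_pos_iff.mpr ⟨⟨w₂, hw₂⟩⟩
    omega
  -- every place other than `w₂` is `w₁`
  have hplace : ∀ w : InfinitePlace K, w ≠ w₂ → w = w₁ := by
    intro w hw
    rcases isReal_or_isComplex w with h | h
    · haveI := Fintype.card_le_one_iff_subsingleton.mp hsig.1.le
      exact congrArg Subtype.val (Subsingleton.elim (⟨w, h⟩ : {w // IsReal w}) ⟨w₁, hw₁⟩)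
    · haveI := Fintype.card_le_one_iff_subsingleton.mp hsig.2.le
      exact absurd (congrArg Subtype.val
        (Subsingleton.elim (⟨w, h⟩ : {w // IsComplex w}) ⟨w₂, hw₂⟩)) hw
  haveI : Subsingleton {w : InfinitePlace K // w ≠ w₂} :=
    ⟨fun a b => Subtype.ext ((hplace a.1 a.2).trans (hplace b.1 b.2).symm)⟩
  let w₁' : {w : InfinitePlace K // w ≠ w₂} := ⟨w₁, ne_of_isReal_isComplex hw₁ hw₂⟩
  have hrank : rank K = 1 := by
    rw [rank, card_eq_nrRealPlaces_add_nrComplexPlaces, hsig.1, hsig.2]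
  haveI : Subsingleton (Fin (rank K)) := by rw [hrank]; infer_instance
  have hc : Fintype.card {w : InfinitePlace K // w ≠ w₂} = Fintype.card (Fin (rank K)) := by
    rw [Fintype.card_fin, hrank, Fintype.card_eq_one_iff]
    exact ⟨w₁', fun _ => Subsingleton.elim _ _⟩
  obtain ⟨e⟩ : Nonempty ({w : InfinitePlace K // w ≠ w₂} ≃ Fin (rank K)) :=
    ⟨Fintype.equivOfCardEq hc⟩
  refine ⟨fundSystem K (e w₁'), ?_, fun u => ?_⟩
  · -- the `1 × 1` regulator determinant at the real place
    have hmult : mult w₁'.val = 1 := mult_isReal ⟨w₁, hw₁⟩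
    have hval : ∀ x : K, w₁'.val x = |σ₁ x| := hw₁app
    rw [regulator_eq_det K w₂ e, Matrix.det_eq_elem_of_subsingleton _ w₁', Matrix.of_apply, hmult,
      Nat.cast_one, one_mul, hval]
  · -- every unit is `ζ g^n`, `ζ` torsion, and `|σ₁ ζ| = w₁ ζ = 1`
    obtain ⟨ζe, hu, -⟩ := exist_unique_eq_mul_prod K u
    refine ⟨ζe.2 (e w₁'), ?_⟩
    rw [Fintype.prod_subsingleton _ (e w₁')] at hu
    have hζ : |σ₁ ((ζe.1 : (𝓞 K)ˣ) : K)| = 1 := by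
      rw [← hw₁app]
      exact (mem_torsion K).mp ζe.1.2 w₁
    rw [hu, NumberField.Units.coe_mul, NumberField.Units.coe_zpow, map_mul, map_zpow₀, abs_mul,
      abs_zpow, hζ, one_mul]

/-- The normalised generator: a real number `c > 1` with `log c = regulator K`, attained as `σ₁ ε`
for some unit `ε`, such that `|σ₁ u|` is an integer power of `c` for every unit `u`. -/
theorem exists_one_lt_log_eq_regulator {K : Type} [Field K] [NumberField K]
    (h3 : Module.finrank ℚ K = 3) (σ₁ : K →+* ℝ) (σ₂ : K →+* ℂ)
    (hσ₂ : ∃ z : K, starRingEnd ℂ (σ₂ z) ≠ σ₂ z) :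
    ∃ c : ℝ, 1 < c ∧ Real.log c = regulator K ∧ (∃ ε : (𝓞 K)ˣ, σ₁ (ε : K) = c) ∧
      ∀ u : (𝓞 K)ˣ, ∃ n : ℤ, |σ₁ (u : K)| = c ^ n := by
  obtain ⟨g, hreg, hpow⟩ := exists_unit_regulator_eq_abs_log h3 σ₁ σ₂ hσ₂
  -- adjust the sign: `σ₁ (±g) = |σ₁ g|`
  obtain ⟨g', hg'⟩ : ∃ g' : (𝓞 K)ˣ, σ₁ (g' : K) = |σ₁ (g : K)| := by
    rcases le_or_gt 0 (σ₁ (g : K)) with h | h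
    · exact ⟨g, (abs_of_nonneg h).symm⟩
    · exact ⟨-g, by rw [Units.val_neg, map_neg, map_neg, abs_of_neg h]⟩
  set b := |σ₁ (g : K)| with hb
  have hb0 : 0 < b := abs_pos.mpr ((map_ne_zero σ₁).mpr (coe_ne_zero g))
  have hb1 : b ≠ 1 := fun h => regulator_ne_zero K (by rw [hreg, h, Real.log_one, abs_zero])
  rcases hb1.lt_or_gt with hlt | hgt
  · -- `b < 1`: take `c = b⁻¹ = σ₁ (g'⁻¹)`
    refine ⟨b⁻¹, (one_lt_inv₀ hb0).mpr hlt, ?_, ⟨g'⁻¹, ?_⟩, fun u => ?_⟩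
    · rw [Real.log_inv, hreg, abs_of_neg (Real.log_neg hb0 hlt)]
    · rw [map_units_inv, map_inv₀, hg']
    · obtain ⟨n, hn⟩ := hpow u
      exact ⟨-n, by rw [hn, inv_zpow', neg_neg]⟩
  · -- `1 < b`: take `c = b = σ₁ g'`
    exact ⟨b, hgt, by rw [hreg, abs_of_pos (Real.log_pos hgt)], ⟨g', hg'⟩, hpow⟩

/-- **S2 `stub_regulatorPeriod`** (Dirichlet for signature `(1, 1)`). A cubic number field `K` with a
real embedding `σ₁` and a NON-REAL embedding `σ₂` has a unit `ε` of `𝓞 K` with `σ₁ ε > 1` which is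
LEAST with this property, and `log σ₁(ε)` is Mathlib's regulator of `K` — the period of the distance
function `log |σ₁ ·|` along the cycle of reduced divisors. -/
theorem stub_regulatorPeriod : ∀ (K : Type) [Field K] [NumberField K], Module.finrank ℚ K = 3 →
    ∀ (σ₁ : K →+* ℝ) (σ₂ : K →+* ℂ), (∃ z : K, starRingEnd ℂ (σ₂ z) ≠ σ₂ z) →
    ∃ ε : (𝓞 K)ˣ, 1 < σ₁ ((ε : 𝓞 K) : K) ∧
      Real.log (σ₁ ((ε : 𝓞 K) : K)) = NumberField.Units.regulator K ∧
      ∀ u : (𝓞 K)ˣ, 1 < σ₁ ((u : 𝓞 K) : K) → σ₁ ((ε : 𝓞 K) : K) ≤ σ₁ ((u : 𝓞 K) : K) := by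
  intro K _ _ h3 σ₁ σ₂ hσ₂
  obtain ⟨c, hc1, hreg, ⟨ε, hε⟩, hpow⟩ := exists_one_lt_log_eq_regulator h3 σ₁ σ₂ hσ₂
  refine ⟨ε, ?_, ?_, fun u hu => ?_⟩
  · rw [NumberField.Units.coe_coe, hε]
    exact hc1
  · rw [NumberField.Units.coe_coe, hε, hreg]
  · rw [NumberField.Units.coe_coe] at hu
    rw [NumberField.Units.coe_coe, NumberField.Units.coe_coe, hε]
    obtain ⟨n, hn⟩ := hpow u
    rw [abs_of_pos (one_pos.trans hu)] at hn
    rw [hn] at hu ⊢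
    have hn1 : 1 ≤ n := by have := (one_lt_zpow_iff_right₀ hc1).mp hu; omega
    calc c = c ^ (1 : ℤ) := (zpow_one c).symm
      _ ≤ c ^ n := zpow_le_zpow_right₀ hc1.le hn1

end Summit.QuantumAdvantage.QuantumAdvantage.Theorems.LinnikCubicClassGroups
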